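import Mathlib
import HarnessLib
import Literature.Probability.MarkovChains.MetropolisHastings
import Literature.Probability.MarkovChains.TotalVariation
import Summits.Ventures.LatticeQCDFlow.Exactness.JarzynskiFinite

/-!
# Stochastic normalizing flows are exact: Crooks' identity for protocols mixing Markov steps and bijective layers

HONEST FRAMING: exact (Metropolis-corrected) sampling algorithms for lattice gauge theory;
figures of merit are autocorrelation/cost numbers at stated couplings and volumes; no
continuum-physics claim.

Venture `LatticeQCDFlow` (cell pub-lqcd), topic `Exactness`, FANOUT row 30 (lean-1); extends
`JarzynskiFinite.lean` (E4) from pure annealing protocols to STOCHASTIC NORMALIZING FLOWS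
(finite configuration space).  NEW WORK of the cell; nothing here is cited as a fact.  Printed
counterparts, named only: Crooks 1998/2000 (path-space fluctuation identity), Wu–Köhler–Noé 2020
(stochastic normalizing flows), Caselle–Cellini–Nada–Panero 2022 (SNF for lattice field
theory), Bonanno et al. arXiv:2510.25704 §2 (NE-MCMC with defects / flows for SU(3)).

## Content

A protocol is a sequence of actions `S 0, …, S n` and, for each step `k < n`, a kernel `P k`
together with a WORK INCREMENT `ω k x y` charged on the move `x → y`.  The one algebraic
condition that makes everything work is the per-step balance identity

  `StepBalance (S k) (S (k+1)) (P k) (ω k) :  Σ_x e^{-S k x} · P k x y · e^{-ω k x y} = e^{-S (k+1) y}`.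

* `stepBalance_of_isStationary` — a Markov step leaving `e^{-S (k+1)}` invariant, charged the
  Jarzynski increment `ω x y = S (k+1) x − S k x` (the case of `JarzynskiFinite.lean`);
* `stepBalance_perm` — a DETERMINISTIC BIJECTIVE layer `y = σ x` (`permKernel σ`), charged
  `ω x y = S (k+1) y − S k x` (on a finite space a bijection has unit "Jacobian"; in the
  continuum this is where `− log |det ∂σ|` enters, cf. `FlowPushforward.lean`);
* `crooks_general` — the master identity for ANY protocol whose steps each satisfy
  `StepBalance`: `Σ_paths e^{-S 0 (x 0)} Π_k P k (x k) (x (k+1)) e^{-W} f (x n) = Σ_y e^{-S n y} f y`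
  with `W = workGen ω x = Σ_k ω k (x k) (x (k+1))`;
* `snf_jarzynski`, `snf_reweighting` — hence `E[e^{-W}] = Z n / Z 0` and
  `E[e^{-W} f(X n)] = (Z n / Z 0) ⟨f⟩_{S n}` for stochastic normalizing flows: interleaving trained
  bijective layers with exact Monte-Carlo updates and reweighting by `e^{-W}` is EXACT, whatever
  the layers — their quality only enters the variance of `e^{-W}`;
* `work_eq_workGen` — the pure-annealing work of `JarzynskiFinite.lean` is the special case.
-/

namespace Summit.Ventures.LatticeQCDFlow.Exactness

open Finset
open Literature.Probability.MarkovChains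

variable {X : Type*} [Fintype X]

/-! ## Generalized work and the per-step balance identity -/

/-- Generalized work along a path: `W = Σ_{k<n} ω k (x k) (x (k+1))`. -/
noncomputable def workGen {n : ℕ} (ω : Fin n → X → X → ℝ) (x : Fin (n + 1) → X) : ℝ :=
  ∑ k : Fin n, ω k (x k.castSucc) (x k.succ)

/-- **Per-step balance**: the kernel `P`, charged the work increment `ω`, transports the weight
`e^{-S}` to the weight `e^{-S'}`: `Σ_x e^{-S x} P x y e^{-ω x y} = e^{-S' y}` for every `y`. -/
def StepBalance (S S' : X → ℝ) (P : X → X → ℝ) (ω : X → X → ℝ) : Prop :=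
  ∀ y, ∑ x, Real.exp (-S x) * P x y * Real.exp (-ω x y) = Real.exp (-S' y)

omit [Fintype X] in
/-- Peeling the first step off the generalized work. -/
theorem workGen_cons {n : ℕ} (ω : Fin (n + 1) → X → X → ℝ) (x₀ : X) (x : Fin (n + 1) → X) :
    workGen ω (Fin.cons x₀ x : Fin (n + 2) → X) = ω 0 x₀ (x 0) + workGen (fun k => ω k.succ) x := by
  unfold workGen
  rw [Fin.sum_univ_succ]
  simp only [Fin.castSucc_zero, Fin.cons_zero, Fin.cons_succ, Fin.castSucc_succ, Fin.cons_one,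
    Fin.succ_zero_eq_one]

omit [Fintype X] in
/-- The annealing work of `JarzynskiFinite.lean` is the generalized work with the Jarzynski
increments `ω k x y = S (k+1) x − S k x`. -/
theorem work_eq_workGen {n : ℕ} (S : Fin (n + 1) → X → ℝ) (x : Fin (n + 1) → X) :
    work S x = workGen (fun k x' _ => S k.succ x' - S k.castSucc x') x := rfl

/-! ## The two kinds of layers -/

/-- **Markov layer.**  A kernel leaving `e^{-S'}` invariant, charged the Jarzynski increment
`S' x − S x` (action switched, then the move), satisfies the step balance. -/
theorem stepBalance_of_isStationary {S S' : X → ℝ} {P : X → X → ℝ}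
    (hP : IsStationary (fun x => Real.exp (-S' x)) P) :
    StepBalance S S' P fun x _ => S' x - S x := by
  intro y
  have h := hP y
  dsimp only at h
  rw [← h]
  refine sum_congr rfl fun x _ => ?_
  dsimp only
  rw [mul_right_comm, ← Real.exp_add]
  congr 2
  ring

variable [DecidableEq X]

/-- The deterministic kernel of a bijective layer `σ`: `x ↦ σ x` with probability one. -/
noncomputable def permKernel (σ : Equiv.Perm X) (x y : X) : ℝ := if y = σ x then 1 else 0

/-- A bijective layer is a stochastic matrix. -/
theorem permKernel_isRowStochastic (σ : Equiv.Perm X) : IsRowStochastic (permKernel σ) := by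
  refine ⟨fun x y => ?_, fun x => ?_⟩
  · unfold permKernel
    split_ifs
    · exact zero_le_one
    · exact le_rfl
  · simp [permKernel, sum_ite_eq']

/-- **Bijective (flow) layer.**  The deterministic layer `y = σ x`, charged the energy change
`ω x y = S' y − S x`, satisfies the step balance (unit Jacobian on a finite space). -/
theorem stepBalance_perm (σ : Equiv.Perm X) (S S' : X → ℝ) :
    StepBalance S S' (permKernel σ) fun x y => S' y - S x := by
  intro y
  have hite : ∀ x, Real.exp (-S x) * permKernel σ x y * Real.exp (-(S' y - S x)) =
      if x = σ.symm y then Real.exp (-S' y) else 0 := by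
    intro x
    unfold permKernel
    by_cases h : y = σ x
    · rw [if_pos h, if_pos ((Equiv.eq_symm_apply σ).mpr h.symm), mul_one, ← Real.exp_add]
      congr 1
      ring
    · rw [if_neg h, mul_zero, zero_mul, if_neg]
      intro hx
      exact h (by rw [hx, Equiv.apply_symm_apply])
  simp_rw [hite]
  rw [sum_ite_eq' univ (σ.symm y), if_pos (mem_univ _)]

/-! ## Crooks' identity for general protocols -/

omit [DecidableEq X] in
/-- **Master identity (Crooks form) for general protocols.**  If every step satisfies the
balance identity, then for every function `f` of the final configuration
`Σ_paths e^{-S 0 (x 0)} · Π_k P k (x k) (x (k+1)) · e^{-W(x)} · f (x n) = Σ_y e^{-S n y} · f y`,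
`W` the generalized work.  Proof: peel the first step and use its balance identity; induct. -/
theorem crooks_general : ∀ {n : ℕ} (S : Fin (n + 1) → X → ℝ) (P : Fin n → X → X → ℝ)
    (ω : Fin n → X → X → ℝ),
    (∀ k : Fin n, StepBalance (S k.castSucc) (S k.succ) (P k) (ω k)) → ∀ f : X → ℝ,
    ∑ x : Fin (n + 1) → X,
        Real.exp (-S 0 (x 0)) * transProb P x * Real.exp (-workGen ω x) * f (x (Fin.last n)) =
      ∑ y, Real.exp (-S (Fin.last n) y) * f y
  | 0, S, P, ω, _, f => by
    rw [sum_path_zero]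
    refine sum_congr rfl fun x₀ _ => ?_
    simp [transProb, workGen]
  | n + 1, S, P, ω, hb, f => by
    have ih := crooks_general (n := n) (fun k => S k.succ) (fun k => P k.succ) (fun k => ω k.succ)
      (fun k => hb k.succ) f
    rw [sum_path_cons]
    have hsummand : ∀ (x₀ : X) (x : Fin (n + 1) → X),
        Real.exp (-S 0 ((Fin.cons x₀ x : Fin (n + 2) → X) 0)) *
            transProb P (Fin.cons x₀ x : Fin (n + 2) → X) *
            Real.exp (-workGen ω (Fin.cons x₀ x : Fin (n + 2) → X)) *
            f ((Fin.cons x₀ x : Fin (n + 2) → X) (Fin.last (n + 1))) =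
          (Real.exp (-S 0 x₀) * P 0 x₀ (x 0) * Real.exp (-ω 0 x₀ (x 0))) *
            (transProb (fun k => P k.succ) x * Real.exp (-workGen (fun k => ω k.succ) x) *
              f (x (Fin.last n))) := by
      intro x₀ x
      rw [Fin.cons_zero, transProb_cons, workGen_cons, ← Fin.succ_last, Fin.cons_succ, neg_add,
        Real.exp_add]
      ring
    simp_rw [hsummand]
    rw [sum_comm]
    calc ∑ x : Fin (n + 1) → X, ∑ x₀, (Real.exp (-S 0 x₀) * P 0 x₀ (x 0) *
            Real.exp (-ω 0 x₀ (x 0))) *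
            (transProb (fun k => P k.succ) x * Real.exp (-workGen (fun k => ω k.succ) x) *
              f (x (Fin.last n)))
          = ∑ x : Fin (n + 1) → X, Real.exp (-S 1 (x 0)) *
              (transProb (fun k => P k.succ) x * Real.exp (-workGen (fun k => ω k.succ) x) *
                f (x (Fin.last n))) := by
            refine sum_congr rfl fun x _ => ?_
            rw [← sum_mul]
            congr 1
            exact hb 0 (x 0)
      _ = ∑ y, Real.exp (-S (Fin.last (n + 1)) y) * f y := by
            simp only [Fin.succ_last, Fin.succ_zero_eq_one] at ih
            rw [← ih]
            refine sum_congr rfl fun x _ => ?_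
            ring

omit [DecidableEq X] in
/-- **Stochastic normalizing flows are exact (Jarzynski form).**  For any protocol whose steps
each satisfy the balance identity — Markov updates leaving the current Boltzmann weight
invariant (`stepBalance_of_isStationary`) interleaved in any order with deterministic bijective
layers (`stepBalance_perm`) — the chain started in equilibrium at `S 0` has
`E[e^{-W}] = Z n / Z 0`. -/
theorem snf_jarzynski {n : ℕ} (S : Fin (n + 1) → X → ℝ) (P : Fin n → X → X → ℝ)
    (ω : Fin n → X → X → ℝ)
    (hb : ∀ k : Fin n, StepBalance (S k.castSucc) (S k.succ) (P k) (ω k)) :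
    ∑ x : Fin (n + 1) → X, pathLaw (gibbsLaw (S 0)) P x * Real.exp (-workGen ω x) =
      partitionFn (S (Fin.last n)) / partitionFn (S 0) := by
  have h := crooks_general S P ω hb fun _ => 1
  simp only [mul_one] at h
  rw [partitionFn, ← h, sum_div]
  refine sum_congr rfl fun x _ => ?_
  simp only [pathLaw, gibbsLaw, partitionFn]
  ring

omit [DecidableEq X] in
/-- **Stochastic normalizing flows are exact (reweighting form).**  `E[e^{-W} f(X n)] =
(Z n / Z 0) · ⟨f⟩_{S n}`: reweighting the output of a stochastic normalizing flow by `e^{-W}`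
gives target expectations exactly (population identity; the finite-sample ratio estimator is
consistent). -/
theorem snf_reweighting {n : ℕ} [Nonempty X] (S : Fin (n + 1) → X → ℝ) (P : Fin n → X → X → ℝ)
    (ω : Fin n → X → X → ℝ)
    (hb : ∀ k : Fin n, StepBalance (S k.castSucc) (S k.succ) (P k) (ω k)) (f : X → ℝ) :
    ∑ x : Fin (n + 1) → X,
        pathLaw (gibbsLaw (S 0)) P x * Real.exp (-workGen ω x) * f (x (Fin.last n)) =
      partitionFn (S (Fin.last n)) / partitionFn (S 0) *
        ∑ y, gibbsLaw (S (Fin.last n)) y * f y := by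
  have hZ : partitionFn (S (Fin.last n)) ≠ 0 :=
    (sum_pos (fun y _ => Real.exp_pos _) univ_nonempty).ne'
  have h := crooks_general S P ω hb f
  calc ∑ x : Fin (n + 1) → X,
        pathLaw (gibbsLaw (S 0)) P x * Real.exp (-workGen ω x) * f (x (Fin.last n))
        = (∑ x : Fin (n + 1) → X, Real.exp (-S 0 (x 0)) * transProb P x *
            Real.exp (-workGen ω x) * f (x (Fin.last n))) / partitionFn (S 0) := by
          rw [sum_div]
          refine sum_congr rfl fun x _ => ?_
          simp only [pathLaw, gibbsLaw]
          ring
    _ = (∑ y, Real.exp (-S (Fin.last n) y) * f y) / partitionFn (S 0) := by rw [h]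
    _ = partitionFn (S (Fin.last n)) / partitionFn (S 0) *
          ∑ y, gibbsLaw (S (Fin.last n)) y * f y := by
          simp only [gibbsLaw]
          rw [mul_sum, sum_div]
          refine sum_congr rfl fun y _ => ?_
          field_simp

end Summit.Ventures.LatticeQCDFlow.Exactness
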